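import Literature.NumberTheory.LFunctions.KMVSecondMomentBandSqueeze
import HarnessLib

/-!
# The SIGNED second-moment gap at a level and the signed prime-averaged squeeze
(Kowalski–Michel–VanderKam 2000, §6 p. 19: the second-moment display)

Topic `Literature/NumberTheory/LFunctions` (cell landau-siegel §D, family route `PrimeLevelFamEdge`,
crux K_B = `BeyondDiagonalBeatsQuarter`, stmt-Parity-20343; D-0130 line `prime-averaged-squeeze` rev 2).
ONE definition with parameters (nothing asserted) + PROVED theorems, 0 named facts, no Petersson input.

WHY. Line `prime-averaged-squeeze` rev 1 registered as its analytic input the ABSOLUTE defect average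
`Σ_{q ∈ goodPrimes Δ' N} secondDefect X² 1 Δ' q ≤ ε·#goodPrimes` (p523798's object; the second-defect half
of the card's `C⁺`). The referee's pre-read (ls-ref-1 g7, LINEREAD-pas-g7.md 2899a5eb7591fd6f, scratch
W3.lean 1129bb034ddf0e58) observed: `secondDefect ≥ 0` is an absolute value LEVEL BY LEVEL, so an `L¹`
average admits no cancellation ACROSS levels — it is diagonal-only at all but `o(#block)` levels
individually, i.e. pointwise (famE-02) strength in averaged clothing; a level average can help only through
a SIGNED sum. Since the tables `T₂` the value crux quantifies over are LEVEL-FREE, the squeeze survives the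
passage to signed sums verbatim: `Σ_q (Q^h_q − mainScale_q·second) = T₂ · Σ_q mainScale_q + Σ_q O(q̂ log⁻³ q̂)`
and the `mainScale_q` are POSITIVE reals, so no cancellation can occur in the `T₂`-term. This file types the
referee's corrected object and proves the signed squeeze.

WHAT IS DEFINED: `signedSecondGap P Q Δ' q := Q^h(P,Q)(q; q̂^{Δ'}) − mainScale q Δ' · secondMomentForm Δ' P Q`
(`ℂ`-valued; junk `0` at `q = 0`) — the referee's object verbatim (W3.lean `RefProbe.signedSecondGap`).

WHAT IS PROVED: `signedSecondGap_eq` (unfolding), `norm_signedSecondGap` (`= secondDefect · ‖mainScale‖`,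
`q ≥ 40`); `sum_mainScale_eq_ofReal` / `norm_sum_mainScale` (block sums of the scale are the positive reals
`Σ ‖mainScale‖`); THE SIGNED SQUEEZE `T₂_eq_zero_of_signedGap_average` — under `MomentAsymptotics`, if
`‖Σ_{q ∈ goodPrimes Δ' N} signedSecondGap P Q Δ' q‖ ≤ ε · Σ_{q ∈ goodPrimes Δ' N} ‖mainScale q Δ'‖`
eventually in `N` for every `ε > 0`, then `T₂ Δ' P Q = 0`; its one-sided twin
`T₂_nonpos_of_signedGap_re_average` (`re Σ gap ≤ ε Σ‖mainScale‖` eventually ⇒ `T₂ ≤ 0`);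
`signedGap_average_of_secondDefect_average` (rev 1's absolute average ⇒ the signed average: A ⇒ A′); and
the value-crux bodies `beatsQuarter_window_of_signedGap_average_X_sq`,
`beatsQuarter_of_bettin_of_signedGap_average_X_sq` (`Bettin →` K_B body from A′ at `(X², 1)`).

WHAT THIS IS NOT: no claim that any signed average is small beyond the diagonal (famE-02 OPEN IN PRINT;
Iwaniec–Sarnak's level average is over ALL levels, acq-11417); a REDUCTION. «The programme SEARCHES and
TYPES; no claim about Landau–Siegel zeros, Theorems 1–2 of arXiv:2211.02515 or a repaired Margin232
until a kernel theorem says so.»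

## References

* [KowalskiMichelVanderKam2000] J. reine angew. Math. 526 (2000) 1–34: §6 p. 19 (second-moment
  display), Thm. 6.1 (32), §2 p. 7 (`M ∉ ℤ`). [held: paper:doi-10-1515-crll-2000-074 p0007, p0019–p0021]
* [Bettin2017] S. Bettin, Thm. 1.1. [held: paper:arxiv-1605.02440 p0003]
-/

noncomputable section

namespace Literature.NumberTheory.LFunctions.KMV2000

open Polynomial Finset
open scoped _root_.Real

/-! ## §1. The signed gap -/

/-- **The SIGNED second-moment gap at level `q`** (mollifier length `q̂^{Δ'}`):
`Q^h(P,Q) − mainScale q Δ' · secondMomentForm Δ' P Q`, a complex number (junk `0` at `q = 0`). Its norm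
is `secondDefect P Q Δ' q · ‖mainScale q Δ'‖`; unlike the defect it can CANCEL across levels. (Object of
the referee ls-ref-1's line pre-read of `prime-averaged-squeeze`, W3.lean.) A definition with parameters;
nothing is asserted. [cite: KowalskiMichelVanderKam2000, §6 p. 19 (second-moment display)] -/
def signedSecondGap (P Q : ℝ[X]) (Δ' : ℝ) (q : ℕ) : ℂ :=
  if hq : q = 0 then 0 else
    haveI : NeZero q := ⟨hq⟩
    QhPQ q P Q (qhat q ^ Δ') - mainScale q Δ' * ((secondMomentForm Δ' P Q : ℝ) : ℂ)

variable {q : ℕ}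

/-- Unfolding at a non-zero level. [cite: KowalskiMichelVanderKam2000, §6 p. 19 (second-moment display)] -/
theorem signedSecondGap_eq [NeZero q] (P Q : ℝ[X]) (Δ' : ℝ) :
    signedSecondGap P Q Δ' q =
      QhPQ q P Q (qhat q ^ Δ') - mainScale q Δ' * ((secondMomentForm Δ' P Q : ℝ) : ℂ) := by
  unfold signedSecondGap
  rw [dif_neg (NeZero.ne q)]

/-- `‖signedSecondGap‖ = secondDefect · ‖mainScale‖` (level `q ≥ 40`, where the scale is non-zero).
[cite: KowalskiMichelVanderKam2000, §6 p. 19 (second-moment display)] -/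
theorem norm_signedSecondGap [NeZero q] (hq : 40 ≤ q) (P Q : ℝ[X]) {Δ' : ℝ} (hΔ' : 0 < Δ') :
    ‖signedSecondGap P Q Δ' q‖ = secondDefect P Q Δ' q * ‖mainScale q Δ'‖ := by
  have hm : 0 < ‖mainScale q Δ'‖ := by
    rw [norm_mainScale hq]
    have := lt_trans one_pos (one_lt_qhat hq)
    have := Real.log_pos (one_lt_qhat hq)
    positivity
  rw [signedSecondGap_eq, secondDefect_eq, ← mainScale_eq_unfolded, div_mul_cancel₀ _ hm.ne']
where
  /-- `mainScale` unfolded at a non-zero level (auxiliary). -/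
  mainScale_eq_unfolded : mainScale q Δ' =
      2 * riemannZeta 2 ^ 2 * ((qhat q / (Δ' ^ 2 * Real.log (qhat q) ^ 2) : ℝ) : ℂ) := by
    unfold mainScale; rw [dif_neg (NeZero.ne q)]

/-! ## §2. Block sums of the scale -/

/-- The total real form of the scale: `2(π²/6)² (√q/2π)/(Δ'² log²(√q/2π))` (`= ‖mainScale q Δ'‖` at every
non-zero level; `≥ 0`). [cite: KowalskiMichelVanderKam2000, §6 p. 19 (second-moment display)] -/
def mainScaleReal (Δ' : ℝ) (q : ℕ) : ℝ :=
  2 * (π ^ 2 / 6) ^ 2 * (Real.sqrt q / (2 * π) / (Δ' ^ 2 * Real.log (Real.sqrt q / (2 * π)) ^ 2))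

/-- `mainScaleReal Δ' q ≥ 0`. [cite: KowalskiMichelVanderKam2000, §6 p. 19] -/
theorem mainScaleReal_nonneg (Δ' : ℝ) (q : ℕ) : 0 ≤ mainScaleReal Δ' q := by
  unfold mainScaleReal; positivity

/-- At a non-zero level `mainScale q Δ' = mainScaleReal Δ' q` (as a complex number).
[cite: KowalskiMichelVanderKam2000, §6 p. 19] -/
theorem mainScale_eq_mainScaleReal [NeZero q] (Δ' : ℝ) :
    mainScale q Δ' = ((mainScaleReal Δ' q : ℝ) : ℂ) := by
  rw [mainScale_eq_ofReal]; rfl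

/-- `‖mainScale q Δ'‖ = mainScaleReal Δ' q` at a non-zero level. [cite: KowalskiMichelVanderKam2000, §6 p. 19] -/
theorem norm_mainScale_eq_mainScaleReal [NeZero q] (Δ' : ℝ) : ‖mainScale q Δ'‖ = mainScaleReal Δ' q := by
  rw [mainScale_eq_mainScaleReal, Complex.norm_real, Real.norm_eq_abs,
    abs_of_nonneg (mainScaleReal_nonneg Δ' q)]

/-- Over a block of good primes the scales sum to the (cast of the) positive real `Σ ‖mainScale‖`.
[cite: KowalskiMichelVanderKam2000, §6 p. 19] -/
theorem sum_mainScale_eq_ofReal (Δ' : ℝ) (N : ℕ) :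
    ∑ q ∈ goodPrimes Δ' N, mainScale q Δ' =
      ((∑ q ∈ goodPrimes Δ' N, ‖mainScale q Δ'‖ : ℝ) : ℂ) := by
  rw [Complex.ofReal_sum]
  refine Finset.sum_congr rfl fun q hq ↦ ?_
  haveI : NeZero q := ⟨(mem_goodPrimes_iff.1 hq).2.2.1.ne_zero⟩
  rw [norm_mainScale_eq_mainScaleReal, mainScale_eq_mainScaleReal]

/-! ## §3. The signed squeeze -/

/-- **The signed squeeze.** Under `MomentAsymptotics Δlo Δhi T₁ T₂`, at admissible `P`, even-or-odd `Q`,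
`Δ' ∈ (Δlo, Δhi]`, `Δ' > 0` with good primes unbounded: if the SIGNED gaps have block sums
`‖Σ_{q ∈ goodPrimes Δ' N} signedSecondGap P Q Δ' q‖ ≤ ε · Σ_{q ∈ goodPrimes Δ' N} ‖mainScale q Δ'‖` eventually
in `N`, for every `ε > 0`, then `T₂ Δ' P Q = 0`. (The table is level-free and the scales are positive reals:
`Σ_q gap_q = T₂ · Σ_q mainScale_q + Σ_q O(‖mainScale_q‖/log q̂)`, and `‖T₂ · Σ mainScale‖ = |T₂| · Σ‖mainScale‖`.)
[cite: KowalskiMichelVanderKam2000, §6 p. 19 (second-moment display); §2 p. 7 (M ∉ ℤ)] -/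
theorem T₂_eq_zero_of_signedGap_average {Δlo Δhi : ℝ} {T₁ T₂ : ℝ → ℝ[X] → ℝ[X] → ℝ}
    (h : MomentAsymptotics Δlo Δhi T₁ T₂) {P Q : ℝ[X]} (hP : Admissible P) (hQ : IsEvenOrOdd Q)
    {Δ' : ℝ} (h1 : Δlo < Δ') (h2 : Δ' ≤ Δhi) (hΔ' : 0 < Δ') (hgood : GoodPrimesUnbounded Δ')
    (hav : ∀ ε : ℝ, 0 < ε → ∃ N₀ : ℕ, ∀ N : ℕ, N₀ ≤ N →
      ‖∑ q ∈ goodPrimes Δ' N, signedSecondGap P Q Δ' q‖ ≤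
        ε * ∑ q ∈ goodPrimes Δ' N, ‖mainScale q Δ'‖) :
    T₂ Δ' P Q = 0 := by
  by_contra hne
  set t : ℝ := T₂ Δ' P Q with ht
  have hδ : 0 < |t| := abs_pos.2 hne
  -- per-level error bound from the second display: ‖gap_q − mainScale_q·t‖ ≤ (C/log q̂)·‖mainScale_q‖
  obtain ⟨C, q₀, hC⟩ := h P Q hP hQ Δ' h1 h2
  set α : ℝ := π ^ 2 / 6 with hα_def
  have hα : 0 < α := by positivity
  set C' : ℝ := |C| * Δ' ^ 2 / (2 * α ^ 2) with hC'_def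
  have hC' : 0 ≤ C' := by positivity
  have hE : ∀ (q : ℕ) [NeZero q], q.Prime → q₀ ≤ q → 40 ≤ q → (∀ n : ℕ, (n : ℝ) ≠ qhat q ^ Δ') →
      ‖signedSecondGap P Q Δ' q - mainScale q Δ' * ((t : ℝ) : ℂ)‖ ≤
        C' / Real.log (qhat q) * ‖mainScale q Δ'‖ := by
    intro q _ hq hq₀ hq40 hg
    obtain ⟨-, b2⟩ := hC q hq hq₀ hg
    have hqhat : 0 < qhat q := lt_trans one_pos (one_lt_qhat hq40)
    have hlog : 0 < Real.log (qhat q) := Real.log_pos (one_lt_qhat hq40)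
    have e : signedSecondGap P Q Δ' q - mainScale q Δ' * ((t : ℝ) : ℂ) =
        QhPQ q P Q (qhat q ^ Δ') -
          (2 * riemannZeta 2 ^ 2 * ((qhat q / (Δ' ^ 2 * Real.log (qhat q) ^ 2) : ℝ) : ℂ)) *
            ((secondMomentForm Δ' P Q + T₂ Δ' P Q : ℝ) : ℂ) := by
      rw [signedSecondGap_eq, ht]
      unfold mainScale
      rw [dif_neg (NeZero.ne q)]
      push_cast
      ring
    rw [e]
    refine b2.trans ?_
    rw [norm_mainScale hq40]
    have e₂ : C' / Real.log (qhat q) * (2 * (π ^ 2 / 6) ^ 2 * (qhat q / (Δ' ^ 2 * Real.log (qhat q) ^ 2))) =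
        |C| * qhat q * (Real.log (qhat q))⁻¹ ^ 3 := by
      rw [hC'_def, hα_def]; field_simp
    rw [e₂]
    have hs : 0 ≤ qhat q * (Real.log (qhat q))⁻¹ ^ 3 := by positivity
    rw [mul_assoc, mul_assoc]
    exact mul_le_mul_of_nonneg_right (le_abs_self C) hs
  -- choose ε = |t|/4 and a log-threshold with C'/log q̂ ≤ |t|/4
  obtain ⟨N₀, hN₀⟩ := hav (|t| / 4) (by positivity)
  obtain ⟨N₁, hN₁⟩ := exists_log_qhat_ge (4 * C' / |t| + 1)
  obtain ⟨N, hNge, hNne⟩ := exists_goodPrimes_nonempty hgood (max N₀ (max q₀ (max N₁ 40)))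
  have hsum := hN₀ N (le_trans (le_max_left _ _) hNge)
  have hq₀N : q₀ ≤ N := le_trans (le_max_left _ _) (le_trans (le_max_right _ _) hNge)
  have hN₁N : N₁ ≤ N :=
    le_trans (le_max_left _ _) (le_trans (le_max_right _ _) (le_trans (le_max_right _ _) hNge))
  have h40N : 40 ≤ N :=
    le_trans (le_max_right _ _) (le_trans (le_max_right _ _) (le_trans (le_max_right _ _) hNge))
  set s := goodPrimes Δ' N with hs_def
  -- per-level: the error term is at most `(|t|/4)·‖mainScale‖`, and the scale is positive
  have hterm : ∀ q ∈ s,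
      ‖signedSecondGap P Q Δ' q - mainScale q Δ' * ((t : ℝ) : ℂ)‖ ≤ |t| / 4 * ‖mainScale q Δ'‖ ∧
        0 < ‖mainScale q Δ'‖ := by
    intro q hq
    obtain ⟨hqN, -, hqp, hqg⟩ := mem_goodPrimes_iff.1 hq
    haveI : NeZero q := ⟨hqp.ne_zero⟩
    have hq40 : 40 ≤ q := by omega
    have hlgB : 4 * C' / |t| + 1 ≤ Real.log (qhat q) := hN₁ q (by omega)
    have hlgpos : 0 < Real.log (qhat q) := Real.log_pos (one_lt_qhat hq40)
    have hm : 0 < ‖mainScale q Δ'‖ := by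
      rw [norm_mainScale hq40]
      have := lt_trans one_pos (one_lt_qhat hq40)
      positivity
    refine ⟨(hE q hqp (by omega) hq40 (fun n ↦ by simpa [qhat] using hqg n)).trans
      (mul_le_mul_of_nonneg_right ?_ hm.le), hm⟩
    rw [div_le_iff₀ hlgpos]
    have e : 4 * C' / |t| * |t| = 4 * C' := div_mul_cancel₀ _ hδ.ne'
    nlinarith [mul_le_mul_of_nonneg_left hlgB hδ.le]
  have hSpos : 0 < ∑ q ∈ s, ‖mainScale q Δ'‖ :=
    Finset.sum_pos (fun q hq ↦ (hterm q hq).2) hNne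
  -- decomposition of the block sum
  have hdec : ∑ q ∈ s, signedSecondGap P Q Δ' q =
      (∑ q ∈ s, mainScale q Δ') * ((t : ℝ) : ℂ) +
        ∑ q ∈ s, (signedSecondGap P Q Δ' q - mainScale q Δ' * ((t : ℝ) : ℂ)) := by
    rw [Finset.sum_mul, ← Finset.sum_add_distrib]
    exact Finset.sum_congr rfl fun q _ ↦ by ring
  have hmain : ‖(∑ q ∈ s, mainScale q Δ') * ((t : ℝ) : ℂ)‖ = (∑ q ∈ s, ‖mainScale q Δ'‖) * |t| := by
    rw [norm_mul, sum_mainScale_eq_ofReal, Complex.norm_real, Complex.norm_real, Real.norm_eq_abs,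
      Real.norm_eq_abs, abs_of_pos hSpos]
  have herr : ‖∑ q ∈ s, (signedSecondGap P Q Δ' q - mainScale q Δ' * ((t : ℝ) : ℂ))‖ ≤
      |t| / 4 * ∑ q ∈ s, ‖mainScale q Δ'‖ := by
    refine (norm_sum_le _ _).trans ?_
    rw [Finset.mul_sum]
    exact Finset.sum_le_sum fun q hq ↦ (hterm q hq).1
  -- `(Σ‖mS‖)|t| ≤ ‖Σ gap‖ + ‖Σ err‖ ≤ (|t|/4 + |t|/4) Σ‖mS‖`
  have hineq : (∑ q ∈ s, ‖mainScale q Δ'‖) * |t| ≤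
      |t| / 4 * (∑ q ∈ s, ‖mainScale q Δ'‖) + |t| / 4 * ∑ q ∈ s, ‖mainScale q Δ'‖ := by
    have e : (∑ q ∈ s, mainScale q Δ') * ((t : ℝ) : ℂ) =
        ∑ q ∈ s, signedSecondGap P Q Δ' q -
          ∑ q ∈ s, (signedSecondGap P Q Δ' q - mainScale q Δ' * ((t : ℝ) : ℂ)) := by
      rw [hdec]; ring
    rw [← hmain, e]
    exact (norm_sub_le _ _).trans (add_le_add hsum herr)
  nlinarith

/-- **One-sided twin.** If only `re Σ_{q ∈ goodPrimes Δ' N} signedSecondGap P Q Δ' q ≤ ε · Σ ‖mainScale‖`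
eventually in `N` for every `ε > 0` («on signed average the second moment is NOT ABOVE its diagonal
prediction»), then `T₂ Δ' P Q ≤ 0`. [cite: KowalskiMichelVanderKam2000, §6 p. 19 (second-moment display)] -/
theorem T₂_nonpos_of_signedGap_re_average {Δlo Δhi : ℝ} {T₁ T₂ : ℝ → ℝ[X] → ℝ[X] → ℝ}
    (h : MomentAsymptotics Δlo Δhi T₁ T₂) {P Q : ℝ[X]} (hP : Admissible P) (hQ : IsEvenOrOdd Q)
    {Δ' : ℝ} (h1 : Δlo < Δ') (h2 : Δ' ≤ Δhi) (hΔ' : 0 < Δ') (hgood : GoodPrimesUnbounded Δ')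
    (hav : ∀ ε : ℝ, 0 < ε → ∃ N₀ : ℕ, ∀ N : ℕ, N₀ ≤ N →
      (∑ q ∈ goodPrimes Δ' N, signedSecondGap P Q Δ' q).re ≤
        ε * ∑ q ∈ goodPrimes Δ' N, ‖mainScale q Δ'‖) :
    T₂ Δ' P Q ≤ 0 := by
  by_contra hne
  set t : ℝ := T₂ Δ' P Q with ht
  have hδ : 0 < t := lt_of_not_ge hne
  obtain ⟨C, q₀, hC⟩ := h P Q hP hQ Δ' h1 h2
  set α : ℝ := π ^ 2 / 6 with hα_def
  have hα : 0 < α := by positivity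
  set C' : ℝ := |C| * Δ' ^ 2 / (2 * α ^ 2) with hC'_def
  have hC' : 0 ≤ C' := by positivity
  have hE : ∀ (q : ℕ) [NeZero q], q.Prime → q₀ ≤ q → 40 ≤ q → (∀ n : ℕ, (n : ℝ) ≠ qhat q ^ Δ') →
      ‖signedSecondGap P Q Δ' q - mainScale q Δ' * ((t : ℝ) : ℂ)‖ ≤
        C' / Real.log (qhat q) * ‖mainScale q Δ'‖ := by
    intro q _ hq hq₀ hq40 hg
    obtain ⟨-, b2⟩ := hC q hq hq₀ hg
    have hqhat : 0 < qhat q := lt_trans one_pos (one_lt_qhat hq40)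
    have hlog : 0 < Real.log (qhat q) := Real.log_pos (one_lt_qhat hq40)
    have e : signedSecondGap P Q Δ' q - mainScale q Δ' * ((t : ℝ) : ℂ) =
        QhPQ q P Q (qhat q ^ Δ') -
          (2 * riemannZeta 2 ^ 2 * ((qhat q / (Δ' ^ 2 * Real.log (qhat q) ^ 2) : ℝ) : ℂ)) *
            ((secondMomentForm Δ' P Q + T₂ Δ' P Q : ℝ) : ℂ) := by
      rw [signedSecondGap_eq, ht]
      unfold mainScale
      rw [dif_neg (NeZero.ne q)]
      push_cast
      ring
    rw [e]
    refine b2.trans ?_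
    rw [norm_mainScale hq40]
    have e₂ : C' / Real.log (qhat q) * (2 * (π ^ 2 / 6) ^ 2 * (qhat q / (Δ' ^ 2 * Real.log (qhat q) ^ 2))) =
        |C| * qhat q * (Real.log (qhat q))⁻¹ ^ 3 := by
      rw [hC'_def, hα_def]; field_simp
    rw [e₂]
    have hs : 0 ≤ qhat q * (Real.log (qhat q))⁻¹ ^ 3 := by positivity
    rw [mul_assoc, mul_assoc]
    exact mul_le_mul_of_nonneg_right (le_abs_self C) hs
  obtain ⟨N₀, hN₀⟩ := hav (t / 4) (by positivity)
  obtain ⟨N₁, hN₁⟩ := exists_log_qhat_ge (4 * C' / t + 1)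
  obtain ⟨N, hNge, hNne⟩ := exists_goodPrimes_nonempty hgood (max N₀ (max q₀ (max N₁ 40)))
  have hsum := hN₀ N (le_trans (le_max_left _ _) hNge)
  have hq₀N : q₀ ≤ N := le_trans (le_max_left _ _) (le_trans (le_max_right _ _) hNge)
  have hN₁N : N₁ ≤ N :=
    le_trans (le_max_left _ _) (le_trans (le_max_right _ _) (le_trans (le_max_right _ _) hNge))
  have h40N : 40 ≤ N :=
    le_trans (le_max_right _ _) (le_trans (le_max_right _ _) (le_trans (le_max_right _ _) hNge))
  set s := goodPrimes Δ' N with hs_def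
  have hterm : ∀ q ∈ s,
      ‖signedSecondGap P Q Δ' q - mainScale q Δ' * ((t : ℝ) : ℂ)‖ ≤ t / 4 * ‖mainScale q Δ'‖ ∧
        0 < ‖mainScale q Δ'‖ := by
    intro q hq
    obtain ⟨hqN, -, hqp, hqg⟩ := mem_goodPrimes_iff.1 hq
    haveI : NeZero q := ⟨hqp.ne_zero⟩
    have hq40 : 40 ≤ q := by omega
    have hlgB : 4 * C' / t + 1 ≤ Real.log (qhat q) := hN₁ q (by omega)
    have hlgpos : 0 < Real.log (qhat q) := Real.log_pos (one_lt_qhat hq40)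
    have hm : 0 < ‖mainScale q Δ'‖ := by
      rw [norm_mainScale hq40]
      have := lt_trans one_pos (one_lt_qhat hq40)
      positivity
    refine ⟨(hE q hqp (by omega) hq40 (fun n ↦ by simpa [qhat] using hqg n)).trans
      (mul_le_mul_of_nonneg_right ?_ hm.le), hm⟩
    rw [div_le_iff₀ hlgpos]
    have e : 4 * C' / t * t = 4 * C' := div_mul_cancel₀ _ hδ.ne'
    nlinarith [mul_le_mul_of_nonneg_left hlgB hδ.le]
  have hSpos : 0 < ∑ q ∈ s, ‖mainScale q Δ'‖ :=
    Finset.sum_pos (fun q hq ↦ (hterm q hq).2) hNne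
  have hdec : ∑ q ∈ s, signedSecondGap P Q Δ' q =
      (∑ q ∈ s, mainScale q Δ') * ((t : ℝ) : ℂ) +
        ∑ q ∈ s, (signedSecondGap P Q Δ' q - mainScale q Δ' * ((t : ℝ) : ℂ)) := by
    rw [Finset.sum_mul, ← Finset.sum_add_distrib]
    exact Finset.sum_congr rfl fun q _ ↦ by ring
  -- real parts: re(Σ mS · t) = (Σ‖mS‖) t, and re(Σ err) ≥ −‖Σ err‖ ≥ −(t/4) Σ‖mS‖
  have hmain : ((∑ q ∈ s, mainScale q Δ') * ((t : ℝ) : ℂ)).re = (∑ q ∈ s, ‖mainScale q Δ'‖) * t := by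
    rw [sum_mainScale_eq_ofReal, ← Complex.ofReal_mul, Complex.ofReal_re]
  have herr : ‖∑ q ∈ s, (signedSecondGap P Q Δ' q - mainScale q Δ' * ((t : ℝ) : ℂ))‖ ≤
      t / 4 * ∑ q ∈ s, ‖mainScale q Δ'‖ := by
    refine (norm_sum_le _ _).trans ?_
    rw [Finset.mul_sum]
    exact Finset.sum_le_sum fun q hq ↦ (hterm q hq).1
  have hre : (∑ q ∈ s, signedSecondGap P Q Δ' q).re ≥
      (∑ q ∈ s, ‖mainScale q Δ'‖) * t - t / 4 * ∑ q ∈ s, ‖mainScale q Δ'‖ := by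
    rw [hdec, Complex.add_re, hmain]
    have := (abs_le.1 ((Complex.abs_re_le_norm _).trans herr)).1
    linarith
  nlinarith

/-! ## §4. The absolute average implies the signed one (A ⇒ A′) -/

/-- Within a dyadic block the scales are comparable: for `q, q' ∈ (N, 2N]` with `log q̂ ≥ 1` at both,
`‖mainScale q Δ'‖ ≤ 3 · ‖mainScale q' Δ'‖` (`q̂ < √2·q̂'` and `log q̂ < log q̂' + ½ log 2`).
[cite: KowalskiMichelVanderKam2000, §6 p. 19 (second-moment display)] -/
theorem norm_mainScale_le_three_mul {q q' N : ℕ} [NeZero q] [NeZero q'] (hq : N + 1 ≤ q)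
    (hq2 : q ≤ 2 * N) (hq' : N + 1 ≤ q') (hq'2 : q' ≤ 2 * N) (h40 : 40 ≤ q) (h40' : 40 ≤ q')
    (hL : 1 ≤ Real.log (qhat q)) (hL' : 1 ≤ Real.log (qhat q')) (Δ' : ℝ) (hΔ' : 0 < Δ') :
    ‖mainScale q Δ'‖ ≤ 3 * ‖mainScale q' Δ'‖ := by
  rw [norm_mainScale h40, norm_mainScale h40']
  have hx : 0 < qhat q := lt_trans one_pos (one_lt_qhat h40)
  have hx' : 0 < qhat q' := lt_trans one_pos (one_lt_qhat h40')
  set L := Real.log (qhat q) with hL_def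
  set L' := Real.log (qhat q') with hL'_def
  -- `q̂ ≤ √2 · q̂'`
  have hqq : (q : ℝ) ≤ 2 * q' := by
    have : q ≤ 2 * q' := by omega
    exact_mod_cast this
  have hratio : qhat q ≤ Real.sqrt 2 * qhat q' := by
    unfold qhat
    rw [← mul_div_assoc, ← Real.sqrt_mul (by norm_num : (0 : ℝ) ≤ 2)]
    exact div_le_div_of_nonneg_right (Real.sqrt_le_sqrt hqq) (by positivity)
  -- `q̂' ≤ √2 · q̂` as well, hence `L' ≤ L + ½ log 2 ≤ 1.35 L`
  have hqq' : (q' : ℝ) ≤ 2 * q := by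
    have : q' ≤ 2 * q := by omega
    exact_mod_cast this
  have hratio' : qhat q' ≤ Real.sqrt 2 * qhat q := by
    unfold qhat
    rw [← mul_div_assoc, ← Real.sqrt_mul (by norm_num : (0 : ℝ) ≤ 2)]
    exact div_le_div_of_nonneg_right (Real.sqrt_le_sqrt hqq') (by positivity)
  have hlog2 : Real.log 2 < 0.6932 := Real.log_two_lt_d9.trans (by norm_num)
  have hLL : L' ≤ L + Real.log 2 / 2 := by
    have h1 : L' ≤ Real.log (Real.sqrt 2 * qhat q) := by
      rw [hL'_def]; exact Real.log_le_log hx' hratio'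
    have h2 : Real.log (Real.sqrt 2 * qhat q) = Real.log 2 / 2 + L := by
      rw [Real.log_mul (by positivity) hx.ne', Real.log_sqrt (by norm_num : (0 : ℝ) ≤ 2), hL_def]
    linarith
  have hsqrt2 : Real.sqrt 2 < 1.4143 := by
    rw [show (1.4143 : ℝ) = Real.sqrt (1.4143 ^ 2) by rw [Real.sqrt_sq (by norm_num)]]
    exact Real.sqrt_lt_sqrt (by norm_num) (by norm_num)
  have hL135 : L' ≤ 1.35 * L := by nlinarith
  -- compare the two scales
  have hL'pos : 0 < L' := by linarith
  have hLpos : 0 < L := by linarith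
  rw [show 3 * (2 * (π ^ 2 / 6) ^ 2 * (qhat q' / (Δ' ^ 2 * L' ^ 2))) =
      2 * (π ^ 2 / 6) ^ 2 * (3 * qhat q' / (Δ' ^ 2 * L' ^ 2)) by ring]
  refine mul_le_mul_of_nonneg_left ?_ (by positivity)
  rw [div_le_div_iff₀ (by positivity) (by positivity)]
  -- goal: q̂ · (Δ'² L'²) ≤ 3 q̂' · (Δ'² L²)
  have h1 : qhat q * L' ^ 2 ≤ Real.sqrt 2 * qhat q' * (1.35 * L) ^ 2 := by
    have : L' ^ 2 ≤ (1.35 * L) ^ 2 := pow_le_pow_left₀ hL'pos.le hL135 2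
    calc qhat q * L' ^ 2 ≤ (Real.sqrt 2 * qhat q') * L' ^ 2 :=
          mul_le_mul_of_nonneg_right hratio (sq_nonneg _)
      _ ≤ (Real.sqrt 2 * qhat q') * (1.35 * L) ^ 2 :=
          mul_le_mul_of_nonneg_left this (by positivity)
  have h2 : Real.sqrt 2 * qhat q' * (1.35 * L) ^ 2 ≤ 3 * qhat q' * L ^ 2 := by
    have : Real.sqrt 2 * 1.35 ^ 2 ≤ 3 := by nlinarith [Real.sqrt_nonneg 2]
    nlinarith [mul_pos hx' (sq_pos_of_pos hLpos)]
  nlinarith [sq_nonneg Δ', h1, h2, mul_pos (sq_pos_of_pos hΔ') hx]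

/-- **A ⇒ A′.** The ABSOLUTE defect average of line `prime-averaged-squeeze` rev 1 implies the SIGNED
block average of rev 2: `‖Σ gap‖ ≤ Σ ‖gap‖ = Σ defect·‖mainScale‖ ≤ 3‖mainScale_{q₁}‖·Σ defect` and
`Σ‖mainScale‖ ≥ #block·‖mainScale_{q₁}‖/3` for any fixed `q₁` of the block.
[cite: KowalskiMichelVanderKam2000, §6 p. 19 (second-moment display)] -/
theorem signedGap_average_of_secondDefect_average {P Q : ℝ[X]} {Δ' : ℝ} (hΔ' : 0 < Δ')
    (hav : ∀ ε : ℝ, 0 < ε → ∃ N₀ : ℕ, ∀ N : ℕ, N₀ ≤ N →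
      ∑ q ∈ goodPrimes Δ' N, secondDefect P Q Δ' q ≤ ε * (goodPrimes Δ' N).card) :
    ∀ ε : ℝ, 0 < ε → ∃ N₀ : ℕ, ∀ N : ℕ, N₀ ≤ N →
      ‖∑ q ∈ goodPrimes Δ' N, signedSecondGap P Q Δ' q‖ ≤
        ε * ∑ q ∈ goodPrimes Δ' N, ‖mainScale q Δ'‖ := by
  intro ε hε
  obtain ⟨N₀, hN₀⟩ := hav (ε / 9) (by positivity)
  obtain ⟨N₂, hN₂⟩ := exists_log_qhat_ge 1
  refine ⟨max N₀ (max N₂ 40), fun N hN ↦ ?_⟩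
  set s := goodPrimes Δ' N with hs_def
  have hN₀N : N₀ ≤ N := le_trans (le_max_left _ _) hN
  have hN₂N : N₂ ≤ N := le_trans (le_max_left _ _) (le_trans (le_max_right _ _) hN)
  have h40N : 40 ≤ N := le_trans (le_max_right _ _) (le_trans (le_max_right _ _) hN)
  rcases s.eq_empty_or_nonempty with hs | ⟨q₁, hq₁⟩
  · simp [hs]
  obtain ⟨hq₁N, hq₁2, hq₁p, -⟩ := mem_goodPrimes_iff.1 hq₁
  haveI : NeZero q₁ := ⟨hq₁p.ne_zero⟩
  have h40₁ : 40 ≤ q₁ := by omega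
  have hL₁ : 1 ≤ Real.log (qhat q₁) := hN₂ q₁ (by omega)
  set m₁ : ℝ := ‖mainScale q₁ Δ'‖ with hm₁
  have hm₁pos : 0 < m₁ := by
    rw [hm₁, norm_mainScale h40₁]
    have := lt_trans one_pos (one_lt_qhat h40₁)
    have := Real.log_pos (one_lt_qhat h40₁)
    positivity
  -- comparability inside the block, both directions
  have hcmp : ∀ q ∈ s, ‖mainScale q Δ'‖ ≤ 3 * m₁ ∧ m₁ ≤ 3 * ‖mainScale q Δ'‖ ∧
      ‖signedSecondGap P Q Δ' q‖ = secondDefect P Q Δ' q * ‖mainScale q Δ'‖ := by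
    intro q hq
    obtain ⟨hqN, hq2, hqp, -⟩ := mem_goodPrimes_iff.1 hq
    haveI : NeZero q := ⟨hqp.ne_zero⟩
    have h40q : 40 ≤ q := by omega
    have hLq : 1 ≤ Real.log (qhat q) := hN₂ q (by omega)
    exact ⟨norm_mainScale_le_three_mul hqN hq2 hq₁N hq₁2 h40q h40₁ hLq hL₁ Δ' hΔ',
      norm_mainScale_le_three_mul hq₁N hq₁2 hqN hq2 h40₁ h40q hL₁ hLq Δ' hΔ',
      norm_signedSecondGap h40q P Q hΔ'⟩
  have hsum := hN₀ N hN₀N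
  -- upper bound for the signed sum
  have hup : ‖∑ q ∈ s, signedSecondGap P Q Δ' q‖ ≤ 3 * m₁ * (ε / 9 * s.card) := by
    calc ‖∑ q ∈ s, signedSecondGap P Q Δ' q‖ ≤ ∑ q ∈ s, ‖signedSecondGap P Q Δ' q‖ := norm_sum_le _ _
      _ ≤ ∑ q ∈ s, secondDefect P Q Δ' q * (3 * m₁) := Finset.sum_le_sum fun q hq ↦ by
          rw [(hcmp q hq).2.2]
          exact mul_le_mul_of_nonneg_left (hcmp q hq).1 (secondDefect_nonneg P Q Δ' q)
      _ = 3 * m₁ * ∑ q ∈ s, secondDefect P Q Δ' q := by rw [← Finset.sum_mul, mul_comm]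
      _ ≤ 3 * m₁ * (ε / 9 * s.card) := mul_le_mul_of_nonneg_left hsum (by positivity)
  -- lower bound for the scale sum
  have hlow : (s.card : ℝ) * (m₁ / 3) ≤ ∑ q ∈ s, ‖mainScale q Δ'‖ := by
    have h := Finset.card_nsmul_le_sum s (fun q ↦ ‖mainScale q Δ'‖) (m₁ / 3) fun q hq ↦ by
      have := (hcmp q hq).2.1; linarith
    rwa [nsmul_eq_mul] at h
  calc ‖∑ q ∈ s, signedSecondGap P Q Δ' q‖ ≤ 3 * m₁ * (ε / 9 * s.card) := hup
    _ = ε * ((s.card : ℝ) * (m₁ / 3)) := by ring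
    _ ≤ ε * ∑ q ∈ s, ‖mainScale q Δ'‖ := mul_le_mul_of_nonneg_left hlow hε.le

/-! ## §5. The value crux from the signed average at `(X², 1)` -/

/-- **The value crux from the SIGNED averaged display (A′).** For a window `(1, Δ]` with MA-consistent
`(T₁, T₂)`: if for every `Δ' ∈ (1, b)` the signed gaps at `(X², 1)` have block sums
`‖Σ_{q ∈ goodPrimes Δ' N} signedSecondGap X² 1 Δ' q‖ ≤ ε · Σ ‖mainScale q Δ'‖` eventually in `N` (every
`ε > 0`), and `T₁(·, X², 1) = 0` on `(1, min Δ 2)`, then `P = X²` beats `¼` on `(1, min Δ (min b 2))`.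
[cite: KowalskiMichelVanderKam2000, Thm. 6.1 (32); §6 p. 19; §2 footnote 2] -/
theorem beatsQuarter_window_of_signedGap_average_X_sq {b : ℝ} (hb : 1 < b)
    (hav : ∀ Δ' : ℝ, 1 < Δ' → Δ' < b → ∀ ε : ℝ, 0 < ε → ∃ N₀ : ℕ, ∀ N : ℕ, N₀ ≤ N →
      ‖∑ q ∈ goodPrimes Δ' N, signedSecondGap (X ^ 2) 1 Δ' q‖ ≤
        ε * ∑ q ∈ goodPrimes Δ' N, ‖mainScale q Δ'‖)
    {Δ : ℝ} (hΔ : 1 < Δ) {T₁ T₂ : ℝ → ℝ[X] → ℝ[X] → ℝ} (hMA : MomentAsymptotics 1 Δ T₁ T₂)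
    (hT₁ : ∀ Δ' : ℝ, 1 < Δ' → Δ' < min Δ 2 → T₁ Δ' (X ^ 2) 1 = 0) :
    ∃ a' b' : ℝ, 1 ≤ a' ∧ a' < b' ∧ b' ≤ Δ ∧ a' < 3 / 2 ∧ ∃ P : ℝ[X], Admissible P ∧
      ∀ Δ' : ℝ, a' < Δ' → Δ' < b' →
        1 / 4 < (linForm Δ' P 1 + T₁ Δ' P 1) ^ 2 /
          (2 * (secondMomentForm Δ' P 1 + T₂ Δ' P 1)) := by
  refine ⟨1, min Δ (min b 2), le_rfl, lt_min hΔ (lt_min hb (by norm_num)), min_le_left _ _,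
    by norm_num, X ^ 2, admissible_X_sq, fun Δ' h1 h2 ↦ ?_⟩
  have hΔ'Δ : Δ' ≤ Δ := h2.le.trans (min_le_left _ _)
  have hΔ'b : Δ' < b := lt_of_lt_of_le h2 ((min_le_right _ _).trans (min_le_left _ _))
  have hΔ'2 : Δ' < 2 := lt_of_lt_of_le h2 ((min_le_right _ _).trans (min_le_right _ _))
  have e1 : T₁ Δ' (X ^ 2) 1 = 0 :=
    hT₁ Δ' h1 (lt_min (lt_of_lt_of_le h2 (min_le_left _ _)) hΔ'2)
  have e2 : T₂ Δ' (X ^ 2) 1 = 0 :=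
    T₂_eq_zero_of_signedGap_average hMA admissible_X_sq isEvenOrOdd_one h1 hΔ'Δ (by linarith)
      (goodPrimesUnbounded_of_lt_two (by linarith) hΔ'2) (hav Δ' h1 hΔ'b)
  rw [e1, e2, add_zero, add_zero]
  have h := ratio_one_X_sq (Δ := Δ') (by linarith)
  unfold ratio at h
  rw [h]
  exact quarter_lt_envelope' h1

/-- **`Bettin →` the body of the value crux, from the signed averaged display (A′) at `(X², 1)`.**
The rev-2 form of line `prime-averaged-squeeze` in the KMV vocabulary (antecedent: Bettin 2017 Thm 1.1,
plus the `X²` diagonal main term). [cite: KowalskiMichelVanderKam2000, Thm. 6.1 (32); §6 p. 19] [cite: Bettin2017, Thm. 1.1] -/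
theorem beatsQuarter_of_bettin_of_signedGap_average_X_sq (hB : bettin2017_theorem11_primeLevel)
    (hS : MollifierMainTermAsymp (X ^ 2)) {b : ℝ} (hb : 1 < b)
    (hav : ∀ Δ' : ℝ, 1 < Δ' → Δ' < b → ∀ ε : ℝ, 0 < ε → ∃ N₀ : ℕ, ∀ N : ℕ, N₀ ≤ N →
      ‖∑ q ∈ goodPrimes Δ' N, signedSecondGap (X ^ 2) 1 Δ' q‖ ≤
        ε * ∑ q ∈ goodPrimes Δ' N, ‖mainScale q Δ'‖) :
    ∀ Δ : ℝ, 1 < Δ → ∀ T₁ T₂ : ℝ → ℝ[X] → ℝ[X] → ℝ, MomentAsymptotics 1 Δ T₁ T₂ →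
      ∃ a' b' : ℝ, 1 ≤ a' ∧ a' < b' ∧ b' ≤ Δ ∧ a' < 3 / 2 ∧ ∃ P : ℝ[X], Admissible P ∧
        ∀ Δ' : ℝ, a' < Δ' → Δ' < b' →
          1 / 4 < (linForm Δ' P 1 + T₁ Δ' P 1) ^ 2 /
            (2 * (secondMomentForm Δ' P 1 + T₂ Δ' P 1)) :=
  fun Δ hΔ T₁ T₂ hMA ↦ beatsQuarter_window_of_signedGap_average_X_sq hb hav hΔ hMA
    (firstCorrectionVanishes_of_bettin hB hS Δ hΔ T₁ T₂ hMA)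

end Literature.NumberTheory.LFunctions.KMV2000
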